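import Summits.AnomalousDissipation.AnomalousDissipation.Theorems.QuarticGate.Negative.Laminar
import Summits.AnomalousDissipation.AnomalousDissipation.Theorems.CubicParityLoud.Negative.EnergyRow
import Literature.Analysis.FluidPDE.NSGalerkinFourier
import Literature.Analysis.FluidPDE.BeltramiWavesCurl
import Literature.Analysis.FunctionSpaces.TorusFourierModes

/-!
# Negative knowledge for the crux `MomentParity.QuarticGate` (stmt-AnomalousDissipation-11464):
# level one is inert — the Casimir classification `stub_casimirs` (S2) fails at `N = 1`

(cdisprove g2, cycle 2.) The Euler bracket of level-`N` fields in Fourier coefficients, and the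
small model `N = 1`: the ball `0 < |k|² ≤ 1` carries no triad, so the Galerkin–Euler field `B_1`
vanishes identically, every polynomial observable is a Casimir, and both conjuncts of the lead's
stub S2 are FALSE — `NoCubicCasimir 1` here, `QuadRigidity 1` in `LevelOneQuad.lean`: the natural
strengthening "`∀ N ≥ 1`" of `stub_casimirs : ∃ᶠ N, …` is refuted (harmless for the line, which only
needs frequently many levels, but it pins every use of S2 to `N ≥ 2`).

* `inertialPairing_eq_sum_convectionCoeff` — Euler bracket of a level-`N` field against a band test in
  Fourier coefficients (general `N`).
* `eq_zero_or_eq_zero_of_mem_freqBall_one`, `convectionCoeff_freqBall_one_eq_zero` — no triads in the unit ball.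
* `nsGeneratorPairing_zero_zero_of_level_one`, `euler_bracket_polyGrad_eq_zero_of_level_one` — `B_1 ≡ 0`.
* `NoCubicCasimir` (verbatim conjunct (i) of `stub_casimirs`), `not_noCubicCasimir_one`.
-/

namespace Summit.AnomalousDissipation.AnomalousDissipation.Theorems.QuarticGate.Negative

open MeasureTheory Filter Topology
open scoped ENNReal InnerProductSpace RealInnerProductSpace
open Literature.Analysis.FunctionSpaces Literature.Analysis.FluidPDE
open Summit.AnomalousDissipation.AnomalousDissipation.Theses.MomentParity

-- `Summit.<Summit>.<Problem>` is the tree's mandated summit-side namespace (CONVENTIONS §2); for this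
-- single-conjunct summit the two coincide, so the duplicate is deliberate.
set_option linter.dupNamespace false

noncomputable section

section Coefficients

/-- Local notation for the real Hilbert space `L²(T³; ℝ³)`. -/
local notation "L2T3" => Lp (EuclideanSpace ℝ (Fin 3)) 2 (volume : Measure (UnitAddTorus (Fin 3)))

/-- Fourier coefficients `û(k)` of (the representative of) `u ∈ H`. -/
def coef (u : Torus.energySpace (Fin 3)) (k : Fin 3 → ℤ) : EuclideanSpace ℂ (Fin 3) :=
  UnitAddTorus.mFourierCoeff (EuclideanSpace.complexify ∘
    ((u.1 : L2T3) : UnitAddTorus (Fin 3) → EuclideanSpace ℝ (Fin 3))) k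

/-- Fourier coefficients `ŵ(k)` of a field `w : T³ → ℝ³`. -/
def tcoef (w : UnitAddTorus (Fin 3) → EuclideanSpace ℝ (Fin 3)) (k : Fin 3 → ℤ) :
    EuclideanSpace ℂ (Fin 3) :=
  UnitAddTorus.mFourierCoeff (EuclideanSpace.complexify ∘ w) k

/-- **The Euler bracket in Fourier coefficients.** For a level-`N` field `u ∈ H` and a smooth test
field `w` band-limited to the ball of radius `N`, the inertial pairing
`∫ (u ⊗ u) : ∇w = ∑_{|k| ≤ N} Re ⟪B̂_{k}(û, ŵ), û(k)⟫_ℂ` with the convection symbol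
`B̂_k(û, ŵ) = ∑_{l+m=k} (2πi û(l)·m) ŵ(m)` (`Torus.convectionCoeff`). [folklore] -/
theorem inertialPairing_eq_sum_convectionCoeff {N : ℕ} (u : Torus.energySpace (Fin 3))
    (hu : IsLevel N u) {w : UnitAddTorus (Fin 3) → EuclideanSpace ℝ (Fin 3)} (hw : Torus.IsSmooth w)
    (hwb : ∀ k ∉ (Torus.freqBall N).erase (0 : Fin 3 → ℤ), tcoef w k = 0) :
    Torus.inertialPairing (u.1 : L2T3) w =
      ∑ k ∈ Torus.freqBall N,
        (inner ℂ (Torus.convectionCoeff (Torus.freqBall N) (coef u) (tcoef w) k) (coef u k)).re := by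
  set S : Finset (Fin 3 → ℤ) := Torus.freqBall N with hSdef
  have hS : ∀ k ∈ S, -k ∈ S := Torus.neg_mem_freqBall_of_mem
  set urep : UnitAddTorus (Fin 3) → EuclideanSpace ℝ (Fin 3) := ((u.1 : L2T3) : _ → _) with hurep
  have hmem : MemLp urep 2 volume := Lp.memLp _
  have hint : Integrable urep volume := hmem.integrable one_le_two
  have hcu : Torus.IsConjSymm (coef u) := Torus.isConjSymm_mFourierCoeff hint
  have hcw : Torus.IsConjSymm (tcoef w) := Torus.isConjSymm_mFourierCoeff hw.continuous.integrable_unitAddTorus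
  -- `P_N u = u` a.e. and `P_N w = w` everywhere
  have hu_ae : (fun x => Torus.fourierTruncate N urep x) =ᵐ[volume] urep :=
    Summit.AnomalousDissipation.AnomalousDissipation.Theorems.CubicParityLoud.Negative.fourierTruncate_ae_eq_of_isLevel
      (u := u) hu
  have hw_eq : Torus.fourierTruncate N w = w :=
    Torus.fourierTruncate_eq_self hw.continuous fun k hk =>
      hwb k fun h => (Torus.not_mem_freqBall.2 hk) (Finset.mem_of_mem_erase h)
  have hPu : Torus.fourierTruncate N urep = Torus.realTrigPoly S (coef u) := rfl
  have hPw : Torus.fourierTruncate N w = Torus.realTrigPoly S (tcoef w) := rfl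
  -- rewrite the pairing on trigonometric polynomials
  have h1 : (fun x => ⟪Torus.fderiv w x (urep x), urep x⟫_ℝ) =ᵐ[volume] fun x =>
      ⟪Torus.convect (Torus.realTrigPoly S (coef u)) (Torus.realTrigPoly S (tcoef w)) x,
        Torus.realTrigPoly S (coef u) x⟫_ℝ := by
    filter_upwards [hu_ae] with x hx
    rw [← hPu, ← hPw, hw_eq, Torus.convect, hx]
  unfold Torus.inertialPairing
  rw [integral_congr_ae h1]
  have hsm : Torus.IsSmooth (Torus.convect (Torus.realTrigPoly S (coef u)) (Torus.realTrigPoly S (tcoef w))) :=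
    (Torus.isSmooth_realTrigPoly _ _).convect (Torus.isSmooth_realTrigPoly _ _)
  rw [Torus.integral_inner_realTrigPoly_right hS hcu (hsm.memLp 2)]
  refine Finset.sum_congr rfl fun k _ => ?_
  rw [Torus.mFourierCoeff_convect_realTrigPoly hS hcu hcw]

end Coefficients

/-! ## The combinatorics of the unit ball: no triads -/

section Ball

/-- Integer form of membership in the unit frequency ball. [folklore] -/
theorem sum_sq_le_one_of_mem_freqBall_one {k : Fin 3 → ℤ} (hk : k ∈ Torus.freqBall 1) :
    k 0 ^ 2 + k 1 ^ 2 + k 2 ^ 2 ≤ 1 := by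
  have h := Torus.mem_freqBall.1 hk
  simp only [Torus.freqNormSq, Fin.sum_univ_three, Nat.cast_one, one_pow] at h
  exact_mod_cast h

/-- The arithmetic core: two lattice points of the closed unit ball whose sum is a NONZERO point of
the ball — one of them is zero. [folklore] -/
theorem eq_zero_or_eq_zero_aux (a b c d e f : ℤ) (h1 : a ^ 2 + b ^ 2 + c ^ 2 ≤ 1)
    (h2 : d ^ 2 + e ^ 2 + f ^ 2 ≤ 1) (h3 : (a + d) ^ 2 + (b + e) ^ 2 + (c + f) ^ 2 ≤ 1)
    (h0 : ¬ (a + d = 0 ∧ b + e = 0 ∧ c + f = 0)) :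
    (a = 0 ∧ b = 0 ∧ c = 0) ∨ (d = 0 ∧ e = 0 ∧ f = 0) := by
  by_contra H
  push Not at H
  obtain ⟨Hl, Hm⟩ := H
  have sq1 : ∀ z : ℤ, z ≠ 0 → 1 ≤ z ^ 2 := fun z hz => (one_le_sq_iff_one_le_abs z).2 (Int.one_le_abs hz)
  have hl1 : 1 ≤ a ^ 2 + b ^ 2 + c ^ 2 := by
    by_cases ha : a = 0
    · by_cases hb : b = 0
      · have hc := Hl ha hb
        nlinarith [sq1 c hc, sq_nonneg a, sq_nonneg b]
      · nlinarith [sq1 b hb, sq_nonneg a, sq_nonneg c]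
    · nlinarith [sq1 a ha, sq_nonneg b, sq_nonneg c]
  have hm1 : 1 ≤ d ^ 2 + e ^ 2 + f ^ 2 := by
    by_cases hd : d = 0
    · by_cases he : e = 0
      · have hf := Hm hd he
        nlinarith [sq1 f hf, sq_nonneg d, sq_nonneg e]
      · nlinarith [sq1 e he, sq_nonneg d, sq_nonneg f]
    · nlinarith [sq1 d hd, sq_nonneg e, sq_nonneg f]
  set x : ℤ := a * d + b * e + c * f with hx
  have hexp : (a + d) ^ 2 + (b + e) ^ 2 + (c + f) ^ 2 =
      (a ^ 2 + b ^ 2 + c ^ 2) + (d ^ 2 + e ^ 2 + f ^ 2) + 2 * x := by rw [hx]; ring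
  have h2x : 2 * x ≤ -1 := by linarith
  have hxneg : x < 0 := by linarith
  have hxle : x ≤ -1 := by linarith [Int.lt_iff_add_one_le.1 hxneg]
  have hsum0 : (a + d) ^ 2 + (b + e) ^ 2 + (c + f) ^ 2 ≤ 0 := by linarith
  have had : (a + d) ^ 2 = 0 := by nlinarith [sq_nonneg (a + d), sq_nonneg (b + e), sq_nonneg (c + f)]
  have hbe : (b + e) ^ 2 = 0 := by nlinarith [sq_nonneg (a + d), sq_nonneg (b + e), sq_nonneg (c + f)]
  have hcf : (c + f) ^ 2 = 0 := by nlinarith [sq_nonneg (a + d), sq_nonneg (b + e), sq_nonneg (c + f)]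
  exact h0 ⟨pow_eq_zero_iff two_ne_zero |>.1 had, pow_eq_zero_iff two_ne_zero |>.1 hbe,
    pow_eq_zero_iff two_ne_zero |>.1 hcf⟩

/-- **The unit ball carries no triad**: if `l, m, l + m ∈ freqBall 1` and `l + m ≠ 0` then
`l = 0` or `m = 0`. [folklore] -/
theorem eq_zero_or_eq_zero_of_mem_freqBall_one {l m : Fin 3 → ℤ} (hl : l ∈ Torus.freqBall 1)
    (hm : m ∈ Torus.freqBall 1) (hk : l + m ∈ Torus.freqBall 1) (hk0 : l + m ≠ 0) :
    l = 0 ∨ m = 0 := by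
  have h1 := sum_sq_le_one_of_mem_freqBall_one hl
  have h2 := sum_sq_le_one_of_mem_freqBall_one hm
  have h3 := sum_sq_le_one_of_mem_freqBall_one hk
  simp only [Pi.add_apply] at h3
  have h0 : ¬ (l 0 + m 0 = 0 ∧ l 1 + m 1 = 0 ∧ l 2 + m 2 = 0) := by
    rintro ⟨e0, e1, e2⟩
    refine hk0 (funext fun i => ?_)
    fin_cases i <;> simp [e0, e1, e2]
  rcases eq_zero_or_eq_zero_aux _ _ _ _ _ _ h1 h2 h3 h0 with ⟨e0, e1, e2⟩ | ⟨e0, e1, e2⟩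
  · left; funext i; fin_cases i <;> simp [e0, e1, e2]
  · right; funext i; fin_cases i <;> simp [e0, e1, e2]

/-- **The convection symbol of the unit ball vanishes off the mean mode**: for coefficient
families supported in `(freqBall 1).erase 0`, `B̂_k(c, c') = 0` for every `k ∈ freqBall 1`,
`k ≠ 0`. [folklore] -/
theorem convectionCoeff_freqBall_one_eq_zero {c c' : (Fin 3 → ℤ) → EuclideanSpace ℂ (Fin 3)}
    (hc : ∀ k ∉ (Torus.freqBall 1).erase (0 : Fin 3 → ℤ), c k = 0)
    (hc' : ∀ k ∉ (Torus.freqBall 1).erase (0 : Fin 3 → ℤ), c' k = 0)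
    {k : Fin 3 → ℤ} (hk : k ∈ Torus.freqBall 1) (hk0 : k ≠ 0) :
    Torus.convectionCoeff (Torus.freqBall 1) c c' k = 0 := by
  rw [Torus.convectionCoeff_def]
  refine Finset.sum_eq_zero fun l hl => Finset.sum_eq_zero fun m hm => ?_
  split_ifs with hlm
  · subst hlm
    rcases eq_zero_or_eq_zero_of_mem_freqBall_one hl hm hk hk0 with rfl | rfl
    · rw [hc 0 (by simp)]
      simp
    · rw [hc' 0 (by simp)]
      simp
  · rfl

end Ball

/-! ## Level one is inert -/

section Inert

/-- Local notation for the real Hilbert space `L²(T³; ℝ³)`. -/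
local notation "L2T3" => Lp (EuclideanSpace ℝ (Fin 3)) 2 (volume : Measure (UnitAddTorus (Fin 3)))

/-- **`B_1 ≡ 0`: level one is inert.** For a level-`1` field `u ∈ H` and every smooth test field
band-limited to `(freqBall 1).erase 0`, the Euler bracket vanishes:
`⟨B(u), w⟩ = Torus.nsGeneratorPairing 0 0 u w = 0`. Every polynomial observable is therefore a
Casimir of level-`1` Galerkin–Euler. [folklore] -/
theorem nsGeneratorPairing_zero_zero_of_level_one (u : Torus.energySpace (Fin 3)) (hu : IsLevel 1 u)
    {w : UnitAddTorus (Fin 3) → EuclideanSpace ℝ (Fin 3)} (hw : Torus.IsSmooth w)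
    (hwb : ∀ k ∉ (Torus.freqBall 1).erase (0 : Fin 3 → ℤ), tcoef w k = 0) :
    Torus.nsGeneratorPairing (d := Fin 3) 0 0 u w = 0 := by
  have h0 : Torus.nsGeneratorPairing (d := Fin 3) 0 0 u w = Torus.inertialPairing (u.1 : L2T3) w := by
    unfold Torus.nsGeneratorPairing
    simp
  rw [h0, inertialPairing_eq_sum_convectionCoeff u hu hw hwb]
  refine Finset.sum_eq_zero fun k hk => ?_
  by_cases hk0 : k = 0
  · subst hk0
    rw [show coef u 0 = 0 from hu 0 (by simp)]
    simp
  · have hcu : ∀ k ∉ (Torus.freqBall 1).erase (0 : Fin 3 → ℤ), coef u k = 0 := hu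
    rw [convectionCoeff_freqBall_one_eq_zero hcu hwb hk hk0]
    simp

end Inert

/-! ## Polynomial cylindrical test fields are band tests -/

section PolyGrad

/-- `∇p(u) = Σᵢ ∂ᵢP((u,g)) gᵢ` is smooth. [folklore] -/
theorem isSmooth_polyGrad {m : ℕ} (g : Fin m → UnitAddTorus (Fin 3) → EuclideanSpace ℝ (Fin 3))
    (P : MvPolynomial (Fin m) ℝ) (u : Torus.energySpace (Fin 3)) (hg : ∀ i, Torus.IsSmooth (g i)) :
    Torus.IsSmooth (polyGrad g P u) :=
  Torus.isSmooth_sum_smul Finset.univ _ fun i _ => hg i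

/-- Fourier coefficients of `∇p(u)`: `𝓕(∇p(u))(k) = Σᵢ ∂ᵢP((u,g)) 𝓕(gᵢ)(k)`. [folklore] -/
theorem tcoef_polyGrad {m : ℕ} (g : Fin m → UnitAddTorus (Fin 3) → EuclideanSpace ℝ (Fin 3))
    (P : MvPolynomial (Fin m) ℝ) (u : Torus.energySpace (Fin 3)) (hg : ∀ i, Torus.IsSmooth (g i))
    (k : Fin 3 → ℤ) :
    tcoef (polyGrad g P u) k = ∑ i, ((MvPolynomial.eval (fun j => Torus.pairing u.1 (g j))
      (MvPolynomial.pderiv i P) : ℝ) : ℂ) • tcoef (g i) k := by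
  unfold tcoef polyGrad
  have hfun : (EuclideanSpace.complexify ∘ fun x => ∑ i, (MvPolynomial.eval
      (fun j => Torus.pairing u.1 (g j)) (MvPolynomial.pderiv i P)) • g i x) =
      fun x => ∑ i ∈ Finset.univ, ((((MvPolynomial.eval (fun j => Torus.pairing u.1 (g j))
        (MvPolynomial.pderiv i P) : ℝ) : ℂ)) • (EuclideanSpace.complexify ∘ g i)) x := by
    funext x
    simp only [Function.comp_apply, map_sum, Pi.smul_apply]
    refine Finset.sum_congr rfl fun i _ => ?_
    rw [LinearIsometry.map_smul, Complex.coe_smul]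
  rw [hfun, Torus.mFourierCoeff_finset_sum Finset.univ (fun i _ => ?_)]
  · refine Finset.sum_congr rfl fun i _ => ?_
    rw [Torus.mFourierCoeff_const_smul]
  · exact ((EuclideanSpace.continuous_complexify.comp (hg i).continuous).integrable_unitAddTorus).smul _

/-- `∇p(u)` is band-limited like the `gᵢ`. [folklore] -/
theorem tcoef_polyGrad_eq_zero {N m : ℕ} (g : Fin m → UnitAddTorus (Fin 3) → EuclideanSpace ℝ (Fin 3))
    (P : MvPolynomial (Fin m) ℝ) (u : Torus.energySpace (Fin 3)) (hg : ∀ i, IsBandTest N (g i))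
    {k : Fin 3 → ℤ} (hk : k ∉ (Torus.freqBall N).erase (0 : Fin 3 → ℤ)) :
    tcoef (polyGrad g P u) k = 0 := by
  rw [tcoef_polyGrad g P u (fun i => (hg i).1)]
  refine Finset.sum_eq_zero fun i _ => ?_
  rw [show tcoef (g i) k = 0 from (hg i).2.2.2 k hk, smul_zero]

/-- **At level one every polynomial observable is a Casimir**: the Euler bracket
`{p, B_1}(u) = ⟨B(u), ∇p(u)⟩` vanishes at every level-`1` field, for every polynomial cylindrical
observable with level-`1` band tests. [folklore] -/
theorem euler_bracket_polyGrad_eq_zero_of_level_one {m : ℕ}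
    (g : Fin m → UnitAddTorus (Fin 3) → EuclideanSpace ℝ (Fin 3)) (P : MvPolynomial (Fin m) ℝ)
    (hg : ∀ i, IsBandTest 1 (g i)) (u : Torus.energySpace (Fin 3)) (hu : IsLevel 1 u) :
    Torus.nsGeneratorPairing (d := Fin 3) 0 0 u (polyGrad g P u) = 0 :=
  nsGeneratorPairing_zero_zero_of_level_one u hu (isSmooth_polyGrad g P u fun i => (hg i).1)
    fun _ hk => tcoef_polyGrad_eq_zero g P u hg hk

end PolyGrad

/-! ## S2 (i) fails at level one: a nonzero cubic Casimir -/

section Cubic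

/-- Local notation for the real Hilbert space `L²(T³; ℝ³)`. -/
local notation "L2T3" => Lp (EuclideanSpace ℝ (Fin 3)) 2 (volume : Measure (UnitAddTorus (Fin 3)))

/-- Conjunct (i) of the lead's `stub_casimirs` at level `N` (verbatim): level-`N` Galerkin–Euler
has no nonzero homogeneous cubic polynomial invariant. -/
def NoCubicCasimir (N : ℕ) : Prop :=
  ∀ (m : ℕ) (g : Fin m → UnitAddTorus (Fin 3) → EuclideanSpace ℝ (Fin 3))
    (P : MvPolynomial (Fin m) ℝ), (∀ i, IsBandTest N (g i)) → P.IsHomogeneous 3 →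
    (∀ u : Torus.energySpace (Fin 3), IsLevel N u →
      Torus.nsGeneratorPairing (d := Fin 3) 0 0 u (polyGrad g P u) = 0) →
    ∀ u : Torus.energySpace (Fin 3), IsLevel N u →
      MvPolynomial.eval (fun j => Torus.pairing u.1 (g j)) P = 0

/-- The Kolmogorov field `K_a = a cos(2πx₁)e₀` is band-limited to `(freqBall 1).erase 0`. [folklore] -/
theorem tcoef_kolField_eq_zero (a : ℝ) {k : Fin 3 → ℤ}
    (hk : k ∉ (Torus.freqBall 1).erase (0 : Fin 3 → ℤ)) : tcoef (kolField a) k = 0 := by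
  have h := isLevel_kolState a le_rfl k hk
  rwa [mFourierCoeff_congr_ae (coe_kolState_ae a)] at h

/-- `K_a` is a level-`1` band test. [folklore] -/
theorem isBandTest_kolField (a : ℝ) : IsBandTest 1 (kolField a) :=
  ⟨isSmooth_kolField a, isDivFree_kolField a, hasZeroMean_kolField a, fun _ hk => tcoef_kolField_eq_zero a hk⟩

/-- `([K_a], K_a) = a²/2`. [folklore] -/
theorem pairing_kolState_kolField (a : ℝ) :
    Torus.pairing ((kolState a).1 : L2T3) (kolField a) = a ^ 2 / 2 := by
  unfold Torus.pairing
  rw [← integral_norm_sq_kolField a]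
  refine integral_congr_ae ((coe_kolState_ae a).mono fun x hx => ?_)
  simp only at hx ⊢
  rw [hx, real_inner_self_eq_norm_sq]

/-- **`¬ NoCubicCasimir 1`**: the cubic observable `(u, K_1)³` is a Casimir of level-`1`
Galerkin–Euler (everything is) but does not vanish at `u = [K_1]` (value `(1/2)³`). The
"`∀ N ≥ 1`" strengthening of conjunct (i) of `stub_casimirs` is false; S2 lives at `N ≥ 2`. [folklore] -/
theorem not_noCubicCasimir_one : ¬ NoCubicCasimir 1 := by
  intro h
  have h1 := h 1 (fun _ => kolField 1) (MvPolynomial.X 0 ^ 3) (fun _ => isBandTest_kolField 1)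
    ((MvPolynomial.isHomogeneous_X ℝ (0 : Fin 1)).pow 3)
    (fun u hu => euler_bracket_polyGrad_eq_zero_of_level_one _ _ (fun _ => isBandTest_kolField 1) u hu)
    (kolState 1) (isLevel_kolState 1 le_rfl)
  rw [map_pow, MvPolynomial.eval_X, pairing_kolState_kolField] at h1
  norm_num at h1

end Cubic

end

end Summit.AnomalousDissipation.AnomalousDissipation.Theorems.QuarticGate.Negative
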